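import Literature.MathematicalPhysics.KineticTheory.CollisionTubeMeasure
import Literature.MathematicalPhysics.KineticTheory.CollisionTubeDensityWeight
import Literature.Analysis.FluidPDE.SphereMeasureSymmetry
import HarnessLib

/-!
# The collision-tube functional at rung 0, pair level: one ordered pair has the Enskog tube mean,
# conditionally on the contact hypothesis

Topic `Literature/MathematicalPhysics/KineticTheory` (kind proof; static input of the TUBE side of the
Enskog closure at rung 0, crux line `even-rung-mean-variance` of `JParityClosure.EvenStressEnskog`,
stmt-AtomisticToContinuum-13079).  Fix constant profiles `(a, u, θ)`, `N + 1` spheres of diameter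
`ε = ε_N` on `𝕋³`, the rung-0 local Gibbs law `G_N = zipConfig_# (P_N ⊗ ⊗ᵢ N(u,θ))`
(`HardSphereUniformGas`), an ordered pair `i ≠ j` and the truncated even mark `Ξ_L = evenMarkTrunc k l L`.
The pair's contribution to the collision-tube functional with the density weight frozen at its mean is
`χ(xᵢ) · pairTubeMark ε κ Ξ_L i j x v = χ(xᵢ) · tubeMark κ Ξ_L (ε⁻¹ reprSym (xᵢ − xⱼ)) vᵢ vⱼ`
(`CollisionTubeGeometry`).  **If** the rescaled near-contact pair law of `(i, j)` under `G_N` is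
`Y ε³ ·` Lebesgue up to relative error `ζ` on the shell `1 < ‖q‖ ≤ 1 + δ` with `2Lκ ≤ δ` (the CONTACT
hypothesis, an argument), then (`pair_tubeMark_mean`)

  `|E_{G_N}[χ(xᵢ) pairTubeMark] − (∫χ) · Y ε³ κ Θ̄_L| ≤ C_χ · ζ ε³ κ · 4L² |S²|`,
  `Θ̄_L = ∫∫ Θ Ξ_L (v, v') M(v) M(v') dv dv'`.

Proof: disintegrate (`integral_localGibbsLaw_rung0`, Fubini); for fixed velocities the position
integrand is (shift-invariant) × `χ(xᵢ)`, so translation invariance of `P_N` factors out `∫ χ`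
(`integral_mul_shiftInvariant`); the remaining position average is the integral of the mark against the
law of `ε⁻¹ reprSym (xᵢ − xⱼ)`, which the contact hypothesis compares with `Y ε³ ·` Lebesgue on the
strict tube (`abs_setIntegral_sub_mul_setIntegral_le`; the strict tube of a pair of relative speed `< 2L`
lies in the shell, and the mark vanishes at larger relative speed); in impact coordinates the Lebesgue
integral of the mark is `κ Θ Ξ_L (vᵢ, vⱼ)` (`integral_tubeMark`) and the tube has volume
`≤ κ · 2L · |S²|`; finally the pair `(vᵢ, vⱼ)` is `N(u,θ)^{⊗2}`-distributed (`integral_pi_pair_gauss`).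

References: C. Cercignani, R. Illner, M. Pulvirenti (1994) §2.2 [CIPDiluteGases1994]; H. van Beijeren,
M. H. Ernst, Physica 68 (1973) [VanbeijerenErnst1973]; H. Spohn (1991) Part I §2.3 [Spohn1991].
-/

noncomputable section

open MeasureTheory ProbabilityTheory Set Filter Topology Function
open scoped ENNReal InnerProductSpace BigOperators Pointwise

namespace Literature.MathematicalPhysics.KineticTheory

open Literature.Analysis.FluidPDE

/-! ## The space integral of the tube mark and the volume of the strict tube in `ℝ³` -/

/-- **The space integral of the tube mark is `κ` times the sphere-integrated mark**:
`∫ tubeMark κ Ξ q v v' dq = κ · Θ Ξ v v'` (`integral_tubeMark` on `ℝ³`, `sphereMeasure = volume.toSphere`,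
`hardSphereKernel (v', v) ω = (⟪v' − v, ω⟫)₊`). [folklore] -/
theorem integral_tubeMark_eq_mul_sphereMark {κ : ℝ} (hκ : 0 ≤ κ) {Ξ : V3 × V3 × V3 → ℝ}
    (hΞ : Measurable Ξ) (v v' : V3) :
    ∫ q, tubeMark κ Ξ q v v' = κ * sphereMark Ξ v v' := by
  rw [integral_tubeMark volume hκ hΞ v v', sphereMark, ← integral_const_mul]
  refine integral_congr_ae (ae_of_all _ fun ω => ?_)
  simp only [hardSphereKernel]
  ring

/-- The real volume of the strict tube is at most `κ ‖w‖ |S²|` (`κ ≥ 0`). [folklore] -/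
theorem volume_real_strictTube_le {κ : ℝ} (hκ : 0 ≤ κ) (w : V3) :
    (volume (strictTube κ w)).toReal ≤
      κ * ‖w‖ * (sphereMeasure : Measure (Metric.sphere (0 : V3) 1)).real univ := by
  haveI := isFiniteMeasure_sphereMeasure (E := V3)
  have h := measure_strictTube_le (volume : Measure V3) hκ w
  have hfin : ENNReal.ofReal (κ * ‖w‖) * (volume : Measure V3).toSphere univ ≠ ∞ :=
    ENNReal.mul_ne_top ENNReal.ofReal_ne_top (measure_ne_top _ _)
  have := ENNReal.toReal_mono hfin h
  rwa [ENNReal.toReal_mul, ENNReal.toReal_ofReal (mul_nonneg hκ (norm_nonneg _))] at this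

/-! ## Bounds for the truncated even mark and its sphere integral

(The corresponding lemmas of the Summits-side regularity file of this line cannot be imported into
`Literature/`; the short facts needed here are re-derived in the form used below.) -/

/-- **The sphere-integrated truncated even mark is bounded**: `|Θ Ξ_L v w| ≤ 4L² |S²|` — on the unit
sphere the integrand `Ξ_L(ω, v, w) ((w − v)·ω)₊` is bounded by `2L · 2L` (the mark by `2L`, and it is
supported in `‖w − v‖ < 2L`, where the kernel is `≤ ‖w − v‖`). [folklore] -/
theorem abs_sphereMark_evenMarkTrunc_le_four_mul_sq (k l : Fin 3) {L : ℝ} (hL : 0 ≤ L) (v w : V3) :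
    |sphereMark (evenMarkTrunc k l L) v w| ≤
      4 * L ^ 2 * (sphereMeasure : Measure (Metric.sphere (0 : V3) 1)).real univ := by
  haveI := isFiniteMeasure_sphereMeasure (E := V3)
  have hpt : ∀ ω : Metric.sphere (0 : V3) 1,
      ‖evenMarkTrunc k l L ((ω : V3), v, w) * hardSphereKernel (w, v) ω‖ ≤ 4 * L ^ 2 := by
    intro ω
    have hω : ‖(ω : V3)‖ = 1 := by simp
    have hk0 : 0 ≤ hardSphereKernel (w, v) ω := le_max_right _ _
    have hk1 : hardSphereKernel (w, v) ω ≤ ‖w - v‖ := by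
      unfold hardSphereKernel
      refine max_le ?_ (norm_nonneg _)
      calc ⟪w - v, (ω : V3)⟫_ℝ ≤ ‖w - v‖ * ‖(ω : V3)‖ := real_inner_le_norm _ _
        _ = ‖w - v‖ := by rw [hω, mul_one]
    rw [Real.norm_eq_abs, abs_mul, abs_of_nonneg hk0]
    by_cases h : ‖w - v‖ < 2 * L
    · calc |evenMarkTrunc k l L ((ω : V3), v, w)| * hardSphereKernel (w, v) ω ≤ 2 * L * (2 * L) :=
            mul_le_mul (abs_evenMarkTrunc_le k l hL _) (hk1.trans h.le) hk0 (by linarith)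
        _ = 4 * L ^ 2 := by ring
    · push Not at h
      rw [evenMarkTrunc_eq_zero_of_two_mul_le' k l hL (q := ((ω : V3), v, w)) h, abs_zero, zero_mul]
      positivity
  have h := norm_integral_le_of_norm_le_const (μ := (sphereMeasure : Measure (Metric.sphere (0 : V3) 1)))
    (f := fun ω : Metric.sphere (0 : V3) 1 => evenMarkTrunc k l L ((ω : V3), v, w) * hardSphereKernel (w, v) ω)
    (C := 4 * L ^ 2) (Eventually.of_forall hpt)
  simpa only [Real.norm_eq_abs, sphereMark] using h

/-- The sphere-integrated mark of a continuous mark is jointly measurable in `(v, w)` (Fubini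
measurability of a parametric integral with jointly continuous integrand). [folklore] -/
theorem measurable_sphereMark {Ξ : V3 × V3 × V3 → ℝ} (hΞ : Continuous Ξ) :
    Measurable fun p : V3 × V3 => sphereMark Ξ p.1 p.2 := by
  haveI := isFiniteMeasure_sphereMeasure (E := V3)
  have hc : Continuous (uncurry fun (p : V3 × V3) (ω : Metric.sphere (0 : V3) 1) =>
      Ξ ((ω : V3), p.1, p.2) * hardSphereKernel (p.2, p.1) ω) := by
    unfold hardSphereKernel
    fun_prop
  have h := hc.measurable.stronglyMeasurable.integral_prod_right'
    (ν := (sphereMeasure : Measure (Metric.sphere (0 : V3) 1)))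
  exact h.measurable

/-! ## The rescaled separation of a pair -/

/-- The rescaled minimal-image separation `ε⁻¹ reprSym (xᵢ − xⱼ)` is a measurable function of the
positions. [folklore] -/
theorem measurable_sep (ε : ℝ) {n : ℕ} (i j : Fin n) :
    Measurable fun x : Fin n → T3 => ε⁻¹ • Torus.reprSym (x i - x j) := by
  have h1 : Measurable fun x : Fin n → T3 => x i - x j := (measurable_pi_apply i).sub (measurable_pi_apply j)
  have h2 : Measurable fun x : Fin n → T3 => Torus.reprSym (x i - x j) := Torus.measurable_reprSym.comp h1
  exact h2.const_smul ε⁻¹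

/-! ## Disintegration of a one-particle weight times a shift-invariant observable -/

/-- **Rung-0 mean of `χ(xᵢ) · φ(x, v)` for a shift-invariant `φ`**: for constant profiles
`a, θ > 0`, `u`, `σ ≤ 1/2`, continuous `χ` and bounded jointly measurable `φ` with
`φ(x + c, v) = φ(x, v)`,
`E_{G_N}[χ(xᵢ) φ(x, v)] = (∫ χ) · ∫ (∫ φ(x, v) P_N(dx)) (⊗ₖ N(u,θ))(dv)`
(product structure, Fubini, translation invariance of `P_N`). [folklore] -/
theorem integral_localGibbsLaw_mul_shiftInvariant {σ a θ : ℝ} {u : V3} {N : ℕ}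
    (Φ : HardSphereFlow (Torus.geometry (Fin 3)) (hsDiameter σ N) (N + 1))
    (hσ2 : σ ≤ 1 / 2) (ha : 0 < a) (hθ : 0 < θ) {χ : T3 → ℝ} (hχ : Continuous χ) (i : Fin (N + 1))
    {φ : (Fin (N + 1) → T3) → (Fin (N + 1) → V3) → ℝ} (hφm : Measurable (uncurry φ))
    {B : ℝ} (hφb : ∀ x v, |φ x v| ≤ B) (hφs : ∀ x v (c : T3), φ (x + fun _ => c) v = φ x v) :
    ∫ z, χ (z i).1 * φ (fun m => (z m).1) (fun m => (z m).2)
        ∂(localGibbsLaw σ (fun _ => a) (fun _ => u) (fun _ => θ) N Φ) =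
      (∫ y, χ y) * ∫ v, ∫ x, φ x v ∂posGibbsMeasure (fun _ : T3 => a) (hsDiameter σ N) (N + 1)
        ∂Measure.pi (fun _ : Fin (N + 1) => gaussMeasure u θ) := by
  haveI : IsProbabilityMeasure (posGibbsMeasure (fun _ : T3 => a) (hsDiameter σ N) (N + 1)) :=
    isProbabilityMeasure_posGibbsMeasure continuous_const (fun _ => ha) hσ2 N
  obtain ⟨C, -, hC⟩ := exists_forall_abs_le_of_continuous hχ
  have hC0 : 0 ≤ C := (abs_nonneg _).trans (hC 0)
  have hFm : Measurable fun p : (Fin (N + 1) → T3) × (Fin (N + 1) → V3) => χ (p.1 i) * φ p.1 p.2 :=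
    (hχ.measurable.comp ((measurable_pi_apply i).comp measurable_fst)).mul hφm
  have hFi : Integrable (fun p : (Fin (N + 1) → T3) × (Fin (N + 1) → V3) => χ (p.1 i) * φ p.1 p.2)
      ((posGibbsMeasure (fun _ : T3 => a) (hsDiameter σ N) (N + 1)).prod
        (Measure.pi fun _ : Fin (N + 1) => gaussMeasure u θ)) := by
    refine Integrable.of_bound hFm.aestronglyMeasurable (C * B) (ae_of_all _ fun p => ?_)
    rw [Real.norm_eq_abs, abs_mul]
    exact mul_le_mul (hC _) (hφb _ _) (abs_nonneg _) hC0
  rw [integral_localGibbsLaw_rung0 σ ha.le hθ u N Φ]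
  have e : (fun p : (Fin (N + 1) → T3) × (Fin (N + 1) → V3) =>
      χ (zipConfig p i).1 * φ (fun m => (zipConfig p m).1) (fun m => (zipConfig p m).2)) =
      fun p => χ (p.1 i) * φ p.1 p.2 := by
    funext p
    simp only [zipConfig_apply]
  rw [e, integral_prod_symm _ hFi]
  have hinner : ∀ v : Fin (N + 1) → V3,
      ∫ x, χ (x i) * φ x v ∂posGibbsMeasure (fun _ : T3 => a) (hsDiameter σ N) (N + 1) =
        (∫ y, χ y) * ∫ x, φ x v ∂posGibbsMeasure (fun _ : T3 => a) (hsDiameter σ N) (N + 1) :=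
    fun v => integral_mul_shiftInvariant a (hsDiameter σ N) i hχ
      (hφm.comp (measurable_id.prodMk measurable_const)) (fun x => hφb x v) (fun x c => hφs x v c)
  simp_rw [hinner]
  rw [integral_const_mul]

/-! ## The position average of the tube mark under the contact hypothesis -/

/-- **The configurational average of the tube mark of one pair, under the contact hypothesis.**  If the
law of `ε⁻¹ reprSym (xᵢ − xⱼ)` under a finite measure `P` on positions satisfies
`|P{reprSym (xᵢ − xⱼ) ∈ ε S} − c vol(S)| ≤ e vol(S)` for all measurable `S` in the shell
`1 < ‖q‖ ≤ 1 + δ`, and `2Lκ ≤ δ`, then for all velocities `v, v'`: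
`|∫ tubeMark κ Ξ_L (ε⁻¹ reprSym (xᵢ − xⱼ)) v v' dP − c κ Θ Ξ_L v v'| ≤ e κ · 4L² |S²|`
(the strict tube of a pair of relative speed `< 2L` lies in the shell and has volume `≤ κ · 2L · |S²|`;
`abs_setIntegral_sub_mul_setIntegral_le`, `integral_tubeMark`; at larger relative speed the mark vanishes).
[folklore] -/
theorem abs_integral_tubeMark_sub_le {n : ℕ} (P : Measure (Fin n → T3)) [IsFiniteMeasure P]
    {ε : ℝ} (hε : 0 < ε) (i j : Fin n) (k l : Fin 3) {L κ δ c e : ℝ} (hL : 0 ≤ L) (hκ : 0 ≤ κ)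
    (he : 0 ≤ e) (hLκδ : 2 * L * κ ≤ δ)
    (hC : ∀ S : Set V3, MeasurableSet S → S ⊆ {q | 1 < ‖q‖ ∧ ‖q‖ ≤ 1 + δ} →
      |P.real {x | Torus.reprSym (x i - x j) ∈ ε • S} - c * (volume : Measure V3).real S| ≤
        e * (volume : Measure V3).real S)
    (v v' : V3) :
    |(∫ x, tubeMark κ (evenMarkTrunc k l L) (ε⁻¹ • Torus.reprSym (x i - x j)) v v' ∂P) -
        c * κ * sphereMark (evenMarkTrunc k l L) v v'| ≤
      e * κ * (2 * L * (2 * L) * (sphereMeasure : Measure (Metric.sphere (0 : V3) 1)).real univ) := by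
  set Ξ : V3 × V3 × V3 → ℝ := evenMarkTrunc k l L with hΞdef
  have hΞm : Measurable Ξ := (continuous_evenMarkTrunc k l L).measurable
  have hΞb : ∀ p, |Ξ p| ≤ 2 * L := abs_evenMarkTrunc_le k l hL
  set σS := (sphereMeasure : Measure (Metric.sphere (0 : V3) 1)).real univ with hσS
  have hσS0 : 0 ≤ σS := measureReal_nonneg
  have hR₀ : 0 ≤ e * κ * (2 * L * (2 * L) * σS) := by positivity
  set w := v - v' with hw
  by_cases hwL : ‖w‖ < 2 * L
  · -- the strict tube and the reduced mark
    set T := strictTube κ w with hT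
    have hTm : MeasurableSet T := measurableSet_strictTube κ w
    set h : V3 → ℝ := fun q => Ξ (impactNormal w q, v, v') with hh
    have hhm : Measurable h := hΞm.comp ((measurable_impactNormal w).prodMk measurable_const)
    have hhb : ∀ q, |h q| ≤ 2 * L := fun q => hΞb _
    have hind : (fun q => tubeMark κ Ξ q v v') = T.indicator h := tubeMark_eq_indicator κ Ξ v v'
    -- the law of the rescaled separation
    set ν : Measure V3 := P.map fun x => ε⁻¹ • Torus.reprSym (x i - x j) with hν
    haveI : IsFiniteMeasure ν := by rw [hν]; infer_instance
    have hI : ∫ x, tubeMark κ Ξ (ε⁻¹ • Torus.reprSym (x i - x j)) v v' ∂P = ∫ q in T, h q ∂ν := by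
      rw [← integral_indicator hTm, ← hind, hν,
        integral_map (measurable_sep ε i j).aemeasurable (measurable_tubeMark_left κ hΞm _ _).aestronglyMeasurable]
    have hLeb : ∫ q in T, h q = κ * sphereMark Ξ v v' := by
      rw [← integral_indicator hTm, ← hind, integral_tubeMark_eq_mul_sphereMark hκ hΞm]
    -- the tube lies in the shell
    have hTsub : T ⊆ {q : V3 | 1 < ‖q‖ ∧ ‖q‖ ≤ 1 + δ} := fun q hq => by
      obtain ⟨h1, h2⟩ := strictTube_subset_shell κ w hq
      refine ⟨h1, h2.trans ?_⟩
      have : κ * ‖w‖ ≤ κ * (2 * L) := mul_le_mul_of_nonneg_left hwL.le hκ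
      linarith
    -- the hypothesis, transported to `ν`
    have hCS : ∀ S, MeasurableSet S → S ⊆ T →
        |ν.real S - c * (volume : Measure V3).real S| ≤ e * (volume : Measure V3).real S := by
      intro S hS hST
      have hconv : ν.real S = P.real {x | Torus.reprSym (x i - x j) ∈ ε • S} := by
        rw [measureReal_def, measureReal_def, hν, Measure.map_apply (measurable_sep ε i j) hS]
        congr 1
        congr 1
        ext x
        simp only [mem_preimage, mem_setOf_eq, mem_smul_set_iff_inv_smul_mem₀ hε.ne']
      rw [hconv]
      exact hC S hS (hST.trans hTsub)
    have hfinν : ν T ≠ ∞ := measure_ne_top _ _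
    have hfinμ : (volume : Measure V3) T ≠ ∞ := by
      haveI := isFiniteMeasure_sphereMeasure (E := V3)
      refine ((measure_strictTube_le (volume : Measure V3) hκ w).trans_lt ?_).ne
      exact ENNReal.mul_lt_top ENNReal.ofReal_lt_top (measure_lt_top _ _)
    have hM := abs_setIntegral_sub_mul_setIntegral_le hTm hfinν hfinμ hCS hhm hhb
    -- the error integral
    have hvol : ∫ q in T, |h q| ≤ 2 * L * (κ * (2 * L) * σS) := by
      have h1 : ∫ q in T, |h q| ≤ 2 * L * (volume : Measure V3).real T := by
        have h' := norm_setIntegral_le_of_norm_le_const (μ := (volume : Measure V3)) (s := T)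
          (f := fun q => |h q|) (C := 2 * L) hfinμ.lt_top (fun q _ => by
            rw [Real.norm_eq_abs, abs_abs]; exact hhb q)
        exact (le_abs_self _).trans (by simpa only [Real.norm_eq_abs] using h')
      have h2 : (volume : Measure V3).real T ≤ κ * (2 * L) * σS :=
        (volume_real_strictTube_le hκ w).trans
          (mul_le_mul_of_nonneg_right (mul_le_mul_of_nonneg_left hwL.le hκ) hσS0)
      exact h1.trans (mul_le_mul_of_nonneg_left h2 (by positivity))
    rw [hI]
    rw [hLeb] at hM
    calc |(∫ q in T, h q ∂ν) - c * κ * sphereMark Ξ v v'|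
        = |(∫ q in T, h q ∂ν) - c * (κ * sphereMark Ξ v v')| := by ring_nf
      _ ≤ e * ∫ q in T, |h q| := hM
      _ ≤ e * (2 * L * (κ * (2 * L) * σS)) := mul_le_mul_of_nonneg_left hvol he
      _ = e * κ * (2 * L * (2 * L) * σS) := by ring
  · -- large relative speed: the mark vanishes identically
    push Not at hwL
    have hΞ0 : ∀ m : V3, Ξ (m, v, v') = 0 := fun m =>
      evenMarkTrunc_eq_zero_of_two_mul_le' k l hL (q := (m, v, v')) (by dsimp only; rwa [norm_sub_rev])
    have h0 : ∀ x : Fin n → T3, tubeMark κ Ξ (ε⁻¹ • Torus.reprSym (x i - x j)) v v' = 0 := fun x => by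
      simp only [tubeMark, hΞ0, ite_self]
    have hΘ0 : sphereMark Ξ v v' = 0 := by
      simp only [sphereMark, hΞ0, zero_mul, integral_zero]
    simp only [h0, integral_zero, hΘ0, mul_zero, sub_zero, abs_zero]
    exact hR₀

/-! ## The pair tube mark as a function of positions and velocities -/

/-- The tube mark of the ordered pair `(i, j)` at diameter `ε`, as a function of all positions and all
velocities: `tubeMark κ Ξ (ε⁻¹ reprSym (xᵢ − xⱼ)) vᵢ vⱼ`. [folklore] -/
def pairTubeMark {n : ℕ} (ε κ : ℝ) (Ξ : V3 × V3 × V3 → ℝ) (i j : Fin n) (x : Fin n → T3)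
    (v : Fin n → V3) : ℝ :=
  tubeMark κ Ξ (ε⁻¹ • Torus.reprSym (x i - x j)) (v i) (v j)

/-- The pair tube mark is jointly measurable. [folklore] -/
theorem measurable_pairTubeMark {n : ℕ} (ε κ : ℝ) {Ξ : V3 × V3 × V3 → ℝ} (hΞ : Measurable Ξ)
    (i j : Fin n) : Measurable (uncurry (pairTubeMark ε κ Ξ i j)) := by
  have h3 : Measurable fun p : (Fin n → T3) × (Fin n → V3) =>
      (ε⁻¹ • Torus.reprSym (p.1 i - p.1 j), p.2 i, p.2 j) :=
    ((measurable_sep ε i j).comp measurable_fst).prodMk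
      (((measurable_pi_apply i).comp measurable_snd).prodMk ((measurable_pi_apply j).comp measurable_snd))
  -- (elaborated without expected type: unifying `g ∘ ?f` against the target would unfold `reprSym`)
  have h := (measurable_tubeMark κ hΞ).comp h3
  exact h

/-- The pair tube mark is bounded by any bound of the mark. [folklore] -/
theorem abs_pairTubeMark_le {n : ℕ} (ε κ : ℝ) {Ξ : V3 × V3 × V3 → ℝ} {C : ℝ} (hC : ∀ p, |Ξ p| ≤ C)
    (i j : Fin n) (x : Fin n → T3) (v : Fin n → V3) : |pairTubeMark ε κ Ξ i j x v| ≤ C :=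
  abs_tubeMark_le hC _ _ _

/-- The pair tube mark is invariant under the diagonal torus shift of the positions. [folklore] -/
theorem pairTubeMark_add_const {n : ℕ} (ε κ : ℝ) (Ξ : V3 × V3 × V3 → ℝ) (i j : Fin n)
    (x : Fin n → T3) (v : Fin n → V3) (c : T3) :
    pairTubeMark ε κ Ξ i j (x + fun _ => c) v = pairTubeMark ε κ Ξ i j x v := by
  simp only [pairTubeMark, Pi.add_apply, add_sub_add_right_eq_sub]

/-! ## The pair-level tube mean under the contact hypothesis -/

/-- **One ordered pair has the Enskog tube mean at rung 0, conditionally on the contact hypothesis.**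
For constant profiles `a, θ > 0`, `u`, `0 < σ ≤ 1/2`, `i ≠ j`, continuous `χ` with `|χ| ≤ C_χ`,
`L, κ, ζ ≥ 0` with `2Lκ ≤ δ`, and the contact hypothesis for the pair `(i, j)` at accuracy `ζ` on the
shell of width `δ`:
`|E_{G_N}[χ(xᵢ) · tubeMark κ Ξ_L (ε⁻¹ sepVec xᵢ xⱼ) vᵢ vⱼ] − (∫ χ) · Y(σ³) ε³ κ Θ̄_L| ≤ C_χ · ζ ε³ κ · 4L² |S²|`.
[folklore] -/
theorem pair_tubeMark_mean {σ a θ : ℝ} {u : V3} {N : ℕ}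
    (Φ : HardSphereFlow (Torus.geometry (Fin 3)) (hsDiameter σ N) (N + 1))
    {i j : Fin (N + 1)} (hij : i ≠ j) (hσ : 0 < σ) (hσ2 : σ ≤ 1 / 2) (ha : 0 < a) (hθ : 0 < θ)
    {χ : T3 → ℝ} (hχ : Continuous χ) {Cχ : ℝ} (hCχ : ∀ y, |χ y| ≤ Cχ)
    (k l : Fin 3) {L κ δ ζ : ℝ} (hL : 0 ≤ L) (hκ : 0 ≤ κ) (hζ : 0 ≤ ζ) (hLκδ : 2 * L * κ ≤ δ)
    (hC : ∀ S : Set V3, MeasurableSet S → S ⊆ {q | 1 < ‖q‖ ∧ ‖q‖ ≤ 1 + δ} →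
      |(localGibbsLaw σ (fun _ => a) (fun _ => u) (fun _ => θ) N Φ).real
          {z | Torus.reprSym ((z i).1 - (z j).1) ∈ hsDiameter σ N • S}
        - contactValue (σ ^ 3) * hsDiameter σ N ^ 3 * (volume S).toReal|
        ≤ ζ * hsDiameter σ N ^ 3 * (volume S).toReal) :
    |(∫ z, χ (z i).1 * pairTubeMark (hsDiameter σ N) κ (evenMarkTrunc k l L) i j
          (fun m => (z m).1) (fun m => (z m).2)
        ∂(localGibbsLaw σ (fun _ => a) (fun _ => u) (fun _ => θ) N Φ))
      - (∫ y, χ y) * (contactValue (σ ^ 3) * hsDiameter σ N ^ 3 * κ *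
          ∫ p : V3 × V3, sphereMark (evenMarkTrunc k l L) p.1 p.2 *
            (localMaxwellian 1 θ u p.1 * localMaxwellian 1 θ u p.2))|
      ≤ Cχ * (ζ * hsDiameter σ N ^ 3 * κ *
          (2 * L * (2 * L) * (sphereMeasure : Measure (Metric.sphere (0 : V3) 1)).real univ)) := by
  have hε : 0 < hsDiameter σ N := hsDiameter_pos hσ N
  have hΞm : Measurable (evenMarkTrunc k l L) := (continuous_evenMarkTrunc k l L).measurable
  have hΞb : ∀ p, |evenMarkTrunc k l L p| ≤ 2 * L := abs_evenMarkTrunc_le k l hL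
  haveI hPprob : IsProbabilityMeasure (posGibbsMeasure (fun _ : T3 => a) (hsDiameter σ N) (N + 1)) :=
    isProbabilityMeasure_posGibbsMeasure continuous_const (fun _ => ha) hσ2 N
  have hCχ0 : 0 ≤ Cχ := (abs_nonneg _).trans (hCχ 0)
  have hχb : |∫ y, χ y| ≤ Cχ := by
    have h := norm_integral_le_of_norm_le_const (μ := (volume : Measure T3)) (f := χ) (C := Cχ)
      (ae_of_all _ fun y => by rw [Real.norm_eq_abs]; exact hCχ y)
    simpa only [Real.norm_eq_abs, probReal_univ, mul_one] using h
  have hφb : ∀ x v, |pairTubeMark (hsDiameter σ N) κ (evenMarkTrunc k l L) i j x v| ≤ 2 * L :=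
    abs_pairTubeMark_le _ _ hΞb i j
  -- the disintegration
  rw [integral_localGibbsLaw_mul_shiftInvariant Φ hσ2 ha hθ hχ i
    (measurable_pairTubeMark (hsDiameter σ N) κ hΞm i j) hφb
    (pairTubeMark_add_const (hsDiameter σ N) κ (evenMarkTrunc k l L) i j)]
  -- the contact hypothesis in configurational form
  have hCP : ∀ S : Set V3, MeasurableSet S → S ⊆ {q | 1 < ‖q‖ ∧ ‖q‖ ≤ 1 + δ} →
      |(posGibbsMeasure (fun _ : T3 => a) (hsDiameter σ N) (N + 1)).real
          {x | Torus.reprSym (x i - x j) ∈ hsDiameter σ N • S} -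
        contactValue (σ ^ 3) * hsDiameter σ N ^ 3 * (volume : Measure V3).real S| ≤
        ζ * hsDiameter σ N ^ 3 * (volume : Measure V3).real S := by
    intro S hS hSδ
    have hS' : MeasurableSet {x : Fin (N + 1) → T3 | Torus.reprSym (x i - x j) ∈ hsDiameter σ N • S} := by
      have e : {x : Fin (N + 1) → T3 | Torus.reprSym (x i - x j) ∈ hsDiameter σ N • S} =
          (fun x => (hsDiameter σ N)⁻¹ • Torus.reprSym (x i - x j)) ⁻¹' S := by
        ext x; simp only [mem_setOf_eq, mem_preimage, mem_smul_set_iff_inv_smul_mem₀ hε.ne']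
      rw [e]; exact measurable_sep (hsDiameter σ N) i j hS
    have hconv : (posGibbsMeasure (fun _ : T3 => a) (hsDiameter σ N) (N + 1)).real
        {x | Torus.reprSym (x i - x j) ∈ hsDiameter σ N • S} =
        (localGibbsLaw σ (fun _ => a) (fun _ => u) (fun _ => θ) N Φ).real
          {z | Torus.reprSym ((z i).1 - (z j).1) ∈ hsDiameter σ N • S} := by
      rw [measureReal_def, measureReal_def, ← localGibbsLaw_posEvent σ ha.le hθ u N Φ hS']
      rfl
    rw [hconv]
    exact hC S hS hSδ
  -- the position average for fixed velocities
  have key : ∀ v : Fin (N + 1) → V3,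
      |(∫ x, pairTubeMark (hsDiameter σ N) κ (evenMarkTrunc k l L) i j x v
          ∂posGibbsMeasure (fun _ : T3 => a) (hsDiameter σ N) (N + 1)) -
        contactValue (σ ^ 3) * hsDiameter σ N ^ 3 * κ * sphereMark (evenMarkTrunc k l L) (v i) (v j)| ≤
        ζ * hsDiameter σ N ^ 3 * κ *
          (2 * L * (2 * L) * (sphereMeasure : Measure (Metric.sphere (0 : V3) 1)).real univ) :=
    fun v => abs_integral_tubeMark_sub_le (posGibbsMeasure (fun _ : T3 => a) (hsDiameter σ N) (N + 1))
      hε i j k l hL hκ (by positivity : 0 ≤ ζ * hsDiameter σ N ^ 3) hLκδ hCP (v i) (v j)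
  -- the velocity average
  by_cases hχ0 : ∫ y, χ y = 0
  · rw [hχ0, zero_mul, zero_mul, sub_zero, abs_zero]
    positivity
  have hΘm : Measurable fun p : V3 × V3 => sphereMark (evenMarkTrunc k l L) p.1 p.2 :=
    measurable_sphereMark (continuous_evenMarkTrunc k l L)
  have hpair : ∫ v, sphereMark (evenMarkTrunc k l L) (v i) (v j)
      ∂Measure.pi (fun _ : Fin (N + 1) => gaussMeasure u θ) =
      ∫ p : V3 × V3, sphereMark (evenMarkTrunc k l L) p.1 p.2 *
        (localMaxwellian 1 θ u p.1 * localMaxwellian 1 θ u p.2) :=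
    integral_pi_pair_gauss hθ u hij (f := fun p : V3 × V3 => sphereMark (evenMarkTrunc k l L) p.1 p.2) hΘm
  have hsw : StronglyMeasurable (uncurry fun (v : Fin (N + 1) → V3) (x : Fin (N + 1) → T3) =>
      pairTubeMark (hsDiameter σ N) κ (evenMarkTrunc k l L) i j x v) := by
    have h := ((measurable_pairTubeMark (hsDiameter σ N) κ hΞm i j).comp measurable_swap).stronglyMeasurable
    exact h
  have hIm : Measurable fun v : Fin (N + 1) → V3 =>
      ∫ x, pairTubeMark (hsDiameter σ N) κ (evenMarkTrunc k l L) i j x v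
        ∂posGibbsMeasure (fun _ : T3 => a) (hsDiameter σ N) (N + 1) :=
    hsw.integral_prod_right'.measurable
  have hIint : Integrable (fun v : Fin (N + 1) → V3 =>
      ∫ x, pairTubeMark (hsDiameter σ N) κ (evenMarkTrunc k l L) i j x v
        ∂posGibbsMeasure (fun _ : T3 => a) (hsDiameter σ N) (N + 1))
      (Measure.pi fun _ : Fin (N + 1) => gaussMeasure u θ) := by
    refine Integrable.of_bound hIm.aestronglyMeasurable (2 * L) (ae_of_all _ fun v => ?_)
    have h := norm_integral_le_of_norm_le_const
      (μ := posGibbsMeasure (fun _ : T3 => a) (hsDiameter σ N) (N + 1))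
      (f := fun x => pairTubeMark (hsDiameter σ N) κ (evenMarkTrunc k l L) i j x v) (C := 2 * L)
      (ae_of_all _ fun x => by rw [Real.norm_eq_abs]; exact hφb x v)
    simpa only [probReal_univ, mul_one] using h
  have hΘint : Integrable (fun v : Fin (N + 1) → V3 =>
      contactValue (σ ^ 3) * hsDiameter σ N ^ 3 * κ * sphereMark (evenMarkTrunc k l L) (v i) (v j))
      (Measure.pi fun _ : Fin (N + 1) => gaussMeasure u θ) := by
    have hvij : Measurable fun v : Fin (N + 1) → V3 => (v i, v j) :=
      (measurable_pi_apply i).prodMk (measurable_pi_apply j)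
    have hm := (hΘm.comp hvij).const_mul (contactValue (σ ^ 3) * hsDiameter σ N ^ 3 * κ)
    refine Integrable.of_bound hm.aestronglyMeasurable (|contactValue (σ ^ 3) * hsDiameter σ N ^ 3 * κ| *
      (4 * L ^ 2 * (sphereMeasure : Measure (Metric.sphere (0 : V3) 1)).real univ))
      (ae_of_all _ fun v => ?_)
    · rw [Real.norm_eq_abs, abs_mul]
      exact mul_le_mul_of_nonneg_left (abs_sphereMark_evenMarkTrunc_le_four_mul_sq k l hL _ _) (abs_nonneg _)
  have hbound : |(∫ v, ∫ x, pairTubeMark (hsDiameter σ N) κ (evenMarkTrunc k l L) i j x v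
      ∂posGibbsMeasure (fun _ : T3 => a) (hsDiameter σ N) (N + 1)
      ∂Measure.pi (fun _ : Fin (N + 1) => gaussMeasure u θ)) -
      contactValue (σ ^ 3) * hsDiameter σ N ^ 3 * κ *
        ∫ p : V3 × V3, sphereMark (evenMarkTrunc k l L) p.1 p.2 *
          (localMaxwellian 1 θ u p.1 * localMaxwellian 1 θ u p.2)| ≤
      ζ * hsDiameter σ N ^ 3 * κ *
        (2 * L * (2 * L) * (sphereMeasure : Measure (Metric.sphere (0 : V3) 1)).real univ) := by
    rw [← hpair, ← integral_const_mul, ← integral_sub hIint hΘint]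
    have h := norm_integral_le_of_norm_le_const (μ := Measure.pi fun _ : Fin (N + 1) => gaussMeasure u θ)
      (C := ζ * hsDiameter σ N ^ 3 * κ *
        (2 * L * (2 * L) * (sphereMeasure : Measure (Metric.sphere (0 : V3) 1)).real univ))
      (f := fun v : Fin (N + 1) → V3 =>
        (∫ x, pairTubeMark (hsDiameter σ N) κ (evenMarkTrunc k l L) i j x v
          ∂posGibbsMeasure (fun _ : T3 => a) (hsDiameter σ N) (N + 1)) -
          contactValue (σ ^ 3) * hsDiameter σ N ^ 3 * κ * sphereMark (evenMarkTrunc k l L) (v i) (v j))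
      (ae_of_all _ fun v => by rw [Real.norm_eq_abs]; exact key v)
    simpa only [Real.norm_eq_abs, probReal_univ, mul_one] using h
  rw [← mul_sub, abs_mul]
  exact mul_le_mul hχb hbound (abs_nonneg _) hCχ0

end Literature.MathematicalPhysics.KineticTheory

end
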